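import Mathlib
import Summits.ResolutionOfSingularities.ResolutionOfSingularities.Theorems.WeightedInvariantLocalWeightedDropWildMonicFlagAssembly
import Summits.ResolutionOfSingularities.ResolutionOfSingularities.Theorems.WeightedInvariantLocalWeightedDropWildMonicFlagTripleDefs
import Summits.ResolutionOfSingularities.ResolutionOfSingularities.Theorems.WeightedInvariantLocalWeightedDropWildMonicMaxFlagOrder

/-!
# `WeightedInvariant.LocalWeightedDrop`, line `hasse-ridge-face-selection`, S3ρ sub-stub S3ρD `stub_wildMonicSurfaceDescent`: item D-0
# «maximising flag» — the SWAP SHAPE of the flag family, and the REDUCTION OF THE ATTAIN SHAPE to its two analytic inputs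

Crux item stmt-ResolutionOfSingularities-8899 `LocalWeightedDrop` (route `ResolutionOfSingularities/WeightedInvariant`), engine of the door
`HypersurfaceCentreConstruction` stmt-ResolutionOfSingularities-19897.  [OURS · L1 W4.3, chain w43, res-L1-w43-stub-3 (gen 3), roadmap item D-0
of `L/res-L1-w43-stub-7/S3RHOD-ROADMAP.md` under the S3ρ owners res-type-083 (`…WildMonicFlagAssembly`: the shapes `SwapShape`,
`AttainShape`, `DropShape` of (C9) and the composition `wildMonicSurfaceReductionWon_of_shapes`) / stub-7; spec
`L/res-L1-w43-stub-3/D0-SPEC.md`.  MODEL: Perlega, arXiv:2011.14443 §7.4.3 (Props. 7.4.8–7.4.11).]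

* **`swapShape_isFlagTriple`** — the flag family `WildMonic.IsFlagTriple d` of `…WildMonicFlagTripleDefs` (both orientations by
  construction) has res-type-083's `SwapShape`: one of the three shape obligations of `wildMonicSurfaceReductionWon_of_shapes`, CLOSED.
* **`attainShape_of_bounds_of_attain`** — for ANY triple family `Φ`: res-type-083's `AttainShape Φ p` follows from the two analytic
  inputs of Per17 §7.4.3 at every non-exit position, (D-0c) BOUNDS [Prop. 7.4.8: some triple has `d > 0`; `d ≤ d*`; `n ≥ N ⇒ d = 0`] and
  (D-0d) CLASSWISE `s`-ATTAINMENT [Lemma 7.4.11 ⇐ Prop. 5.3.5: in every class `(D > 0, n)` a triple with finite, greatest `s`], by the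
  order skeleton `WildMonic.exists_isGreatest_triple` (`…WildMonicMaxFlagOrder`, Prop. 7.4.10); `attainShape_of_bounds_of_attain'` —
  the variant with the printed bound `d > 0 ⇒ n < N`.  What remains of D-0 for `Φ = IsFlagTriple d` is exactly to discharge the two
  hypotheses (D-0c with res-type-056's (C8) kangaroo bounds; D-0d with stub-5's limit kernel `…WildMonicMaxFlagLimit` and stub-7's
  secondary cleanness `…WildMonicSClean*`).
-/

set_option linter.dupNamespace false -- mandated namespace of this single-conjunct summit

namespace Summit.ResolutionOfSingularities.ResolutionOfSingularities.Theorems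

namespace WildMonic

open MvPowerSeries
open Literature.AlgebraicGeometry.Resolution
open Literature.AlgebraicGeometry.Resolution.HauserPerlega2024 (Triple)

variable {k : Type} [Field k]

/-! ### The swap shape of the flag family -/

/-- **SWAP SHAPE, CLOSED**: the triples of valid admissible flags of the letter-swapped position with letter-swapped boundary are those of
the position (`…WildMonicFlagTripleDefs.isFlagTriple_swapT`: the orientation bit absorbs the swap).
[cite: Perlega2020, §7.2.3 (arXiv:2011.14443 chunk p0088 L154–L165); HauserPerlega2024, Lemma 1 p. 788 («after possibly swapping x and y»)] -/
theorem swapShape_isFlagTriple (d : ℕ) : SwapShape (IsFlagTriple (k := k) d) :=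
  fun A E v => isFlagTriple_swapT d A E v

/-! ### The attain shape from bounds and classwise attainment -/

/-- **ATTAIN SHAPE ⇐ (D-0c) BOUNDS + (D-0d) CLASSWISE ATTAINMENT** (any triple family `Φ`).  At every position `A` with boundary `E` that
no free move puts in an exit, assume [Per17 Prop. 7.4.8] (i) some `Φ`-triple has `d > 0`, (ii) the `d`-components are bounded,
(iii) `n ≥ N ⇒ d = 0` for some `N`, and [Per17 Lemma 7.4.11] (iv) every class of `Φ`-triples with fixed `d = D > 0` and fixed `n` that
occurs contains a triple whose `s` is finite and greatest in the class.  Then `AttainShape Φ p`: a GREATEST `Φ`-triple with finite `s`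
exists [Per17 Prop. 7.4.10]. [cite: Perlega2020, Props. 7.4.8, 7.4.10, Lemma 7.4.11 (arXiv:2011.14443 §7.4.3, chunks p0092–p0095)] -/
theorem attainShape_of_bounds_of_attain {d : ℕ} (Φ : (Fin d → MvPowerSeries (Fin 2) k) → Finset (Fin 2) → Triple → Prop) (p : ℕ)
    (hbounds : ∀ (A : Fin d → MvPowerSeries (Fin 2) k) (E : Finset (Fin 2)), IsPos d A → ¬ Exit₃ p d A →
      (∃ v, Φ A E v ∧ 0 < (ofLex v).1) ∧ (∃ dstar : ℕ, ∀ v, Φ A E v → (ofLex v).1 ≤ dstar) ∧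
        ∃ N : ℕ, ∀ v, Φ A E v → N ≤ (ofLex (ofLex v).2).1 → (ofLex v).1 = 0)
    (hattain : ∀ (A : Fin d → MvPowerSeries (Fin 2) k) (E : Finset (Fin 2)), IsPos d A → ¬ Exit₃ p d A →
      ∀ D n : ℕ, 0 < D → (∃ v, Φ A E v ∧ (ofLex v).1 = D ∧ (ofLex (ofLex v).2).1 = n) →
        ∃ v, Φ A E v ∧ (ofLex v).1 = D ∧ (ofLex (ofLex v).2).1 = n ∧ (ofLex (ofLex v).2).2 ≠ ⊤ ∧
          ∀ w, Φ A E w → (ofLex w).1 = D → (ofLex (ofLex w).2).1 = n → (ofLex (ofLex w).2).2 ≤ (ofLex (ofLex v).2).2) :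
    AttainShape Φ p := by
  intro A E hA hexit
  obtain ⟨⟨v₀, hv₀, hv₀pos⟩, ⟨dstar, hdstar⟩, ⟨N, hN⟩⟩ := hbounds A E hA hexit
  have hs := hattain A E hA hexit
  obtain ⟨φ, hge, hfin, -⟩ := exists_isGreatest_triple (Φ := {v : Triple // Φ A E v}) (fun v => v.1)
    ⟨⟨v₀, hv₀⟩, hv₀pos⟩ ⟨dstar, fun ψ => hdstar ψ.1 ψ.2⟩ ⟨N, fun ψ hψ => hN ψ.1 ψ.2 hψ⟩
    (fun D n hD hex => by
      obtain ⟨ψ, hψD, hψn⟩ := hex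
      obtain ⟨v, hv, hvD, hvn, hvfin, hvmax⟩ := hs D n hD ⟨ψ.1, ψ.2, hψD, hψn⟩
      exact ⟨⟨v, hv⟩, hvD, hvn, hvfin, fun χ hχD hχn => hvmax χ.1 χ.2 hχD hχn⟩)
  exact ⟨φ.1, φ.2, hfin, fun w hw => hge ⟨w, hw⟩⟩

/-- `attainShape_of_bounds_of_attain` with the bound in its printed form «`d_𝓕 > 0 ⇒ n_𝓕 < N`» [Per17 Prop. 7.4.8 (2)].
[cite: Perlega2020, Props. 7.4.8, 7.4.10, Lemma 7.4.11 (arXiv:2011.14443 §7.4.3, chunks p0092–p0095)] -/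
theorem attainShape_of_bounds_of_attain' {d : ℕ} (Φ : (Fin d → MvPowerSeries (Fin 2) k) → Finset (Fin 2) → Triple → Prop) (p : ℕ)
    (hbounds : ∀ (A : Fin d → MvPowerSeries (Fin 2) k) (E : Finset (Fin 2)), IsPos d A → ¬ Exit₃ p d A →
      (∃ v, Φ A E v ∧ 0 < (ofLex v).1) ∧ (∃ dstar : ℕ, ∀ v, Φ A E v → (ofLex v).1 ≤ dstar) ∧
        ∃ N : ℕ, ∀ v, Φ A E v → 0 < (ofLex v).1 → (ofLex (ofLex v).2).1 < N)
    (hattain : ∀ (A : Fin d → MvPowerSeries (Fin 2) k) (E : Finset (Fin 2)), IsPos d A → ¬ Exit₃ p d A →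
      ∀ D n : ℕ, 0 < D → (∃ v, Φ A E v ∧ (ofLex v).1 = D ∧ (ofLex (ofLex v).2).1 = n) →
        ∃ v, Φ A E v ∧ (ofLex v).1 = D ∧ (ofLex (ofLex v).2).1 = n ∧ (ofLex (ofLex v).2).2 ≠ ⊤ ∧
          ∀ w, Φ A E w → (ofLex w).1 = D → (ofLex (ofLex w).2).1 = n → (ofLex (ofLex w).2).2 ≤ (ofLex (ofLex v).2).2) :
    AttainShape Φ p := by
  refine attainShape_of_bounds_of_attain Φ p (fun A E hA hexit => ?_) hattain
  obtain ⟨h1, h2, N, hN⟩ := hbounds A E hA hexit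
  refine ⟨h1, h2, N, fun v hv hle => ?_⟩
  by_contra hne
  exact absurd (hN v hv (Nat.pos_of_ne_zero hne)) (not_lt.mpr hle)

/-- The greatest triple handed out by `AttainShape` is the greatest element of the set of `Φ`-triples (order-theoretic form, for
`measureΦ`: the supremum `⨆ embed v` is then attained). -/
theorem isGreatest_of_attainShape {d : ℕ} {Φ : (Fin d → MvPowerSeries (Fin 2) k) → Finset (Fin 2) → Triple → Prop} {p : ℕ}
    (h : AttainShape Φ p) {A : Fin d → MvPowerSeries (Fin 2) k} {E : Finset (Fin 2)} (hA : IsPos d A) (hexit : ¬ Exit₃ p d A) :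
    ∃ v, IsGreatest {w : Triple | Φ A E w} v ∧ (ofLex (ofLex v).2).2 ≠ ⊤ := by
  obtain ⟨v, hv, hfin, hmax⟩ := h A E hA hexit
  exact ⟨v, ⟨hv, fun w hw => hmax w hw⟩, hfin⟩

/-! ### The top-class form -/

/-- **ATTAIN SHAPE ⇐ BOUNDS + TOP-CLASS ATTAINMENT**: as `attainShape_of_bounds_of_attain`, but (iv) is only required for the classes
`(D, n)` that are lex-greatest (`D` bounds every `Φ`-triple's first component, `n` bounds the second components in class `D`) — the form
in which Per17 Prop. 5.3.5 delivers `s`-attainment (its hypothesis «`f` `ord`-clean w.r.t. `J₋₁`» = the class has the maximal `d`).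
[cite: Perlega2020, Props. 7.4.8, 7.4.10, Lemma 7.4.11, Prop. 5.3.5 (arXiv:2011.14443 §7.4.3, §5.3)] -/
theorem attainShape_of_bounds_of_attain_top {d : ℕ} (Φ : (Fin d → MvPowerSeries (Fin 2) k) → Finset (Fin 2) → Triple → Prop)
    (p : ℕ)
    (hbounds : ∀ (A : Fin d → MvPowerSeries (Fin 2) k) (E : Finset (Fin 2)), IsPos d A → ¬ Exit₃ p d A →
      (∃ v, Φ A E v ∧ 0 < (ofLex v).1) ∧ (∃ dstar : ℕ, ∀ v, Φ A E v → (ofLex v).1 ≤ dstar) ∧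
        ∃ N : ℕ, ∀ v, Φ A E v → N ≤ (ofLex (ofLex v).2).1 → (ofLex v).1 = 0)
    (hattain : ∀ (A : Fin d → MvPowerSeries (Fin 2) k) (E : Finset (Fin 2)), IsPos d A → ¬ Exit₃ p d A →
      ∀ D n : ℕ, 0 < D → (∃ v, Φ A E v ∧ (ofLex v).1 = D ∧ (ofLex (ofLex v).2).1 = n) →
        (∀ w, Φ A E w → (ofLex w).1 ≤ D) → (∀ w, Φ A E w → (ofLex w).1 = D → (ofLex (ofLex w).2).1 ≤ n) →
        ∃ v, Φ A E v ∧ (ofLex v).1 = D ∧ (ofLex (ofLex v).2).1 = n ∧ (ofLex (ofLex v).2).2 ≠ ⊤ ∧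
          ∀ w, Φ A E w → (ofLex w).1 = D → (ofLex (ofLex w).2).1 = n → (ofLex (ofLex w).2).2 ≤ (ofLex (ofLex v).2).2) :
    AttainShape Φ p := by
  intro A E hA hexit
  obtain ⟨⟨v₀, hv₀, hv₀pos⟩, ⟨dstar, hdstar⟩, ⟨N, hN⟩⟩ := hbounds A E hA hexit
  have hs := hattain A E hA hexit
  obtain ⟨φ, hge, hfin, -⟩ := exists_isGreatest_triple_top (Φ := {v : Triple // Φ A E v}) (fun v => v.1)
    ⟨⟨v₀, hv₀⟩, hv₀pos⟩ ⟨dstar, fun ψ => hdstar ψ.1 ψ.2⟩ ⟨N, fun ψ hψ => hN ψ.1 ψ.2 hψ⟩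
    (fun D n hD hex hDle hnle => by
      obtain ⟨ψ, hψD, hψn⟩ := hex
      obtain ⟨v, hv, hvD, hvn, hvfin, hvmax⟩ := hs D n hD ⟨ψ.1, ψ.2, hψD, hψn⟩ (fun w hw => hDle ⟨w, hw⟩)
        (fun w hw hwD => hnle ⟨w, hw⟩ hwD)
      exact ⟨⟨v, hv⟩, hvD, hvn, hvfin, fun χ hχD hχn => hvmax χ.1 χ.2 hχD hχn⟩)
  exact ⟨φ.1, φ.2, hfin, fun w hw => hge ⟨w, hw⟩⟩

/-! ### The flag family: tangent classes attain trivially -/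

/-- In the flag family `IsFlagTriple d`, a triple with `n > 0` comes from a TANGENT flag and has `s = 0`
(`flagTriple = (dFlagN, n, 0)`); `n = 0` triples are the `IsN0` ones `(dRes, 0, sValue)`. -/
theorem isFlagTriple_thd_eq_zero_of_snd_pos {d : ℕ} {A : Fin d → MvPowerSeries (Fin 2) k} {E : Finset (Fin 2)} {v : Triple}
    (hv : IsFlagTriple d A E v) (hn : 0 < (ofLex (ofLex v).2).1) : (ofLex (ofLex v).2).2 = 0 := by
  obtain ⟨o, g, h, -, -, -, -, rfl⟩ := hv
  by_cases hN0 : PurePowerFlag.IsN0 (PurePowerFlag.orientE o E) h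
  · rw [flagTriple_snd_fst, if_pos hN0] at hn
    exact absurd hn (lt_irrefl 0)
  · exact flagTriple_snd_snd_of_not_isN0 hN0

/-- **D-0 FOR THE FLAG FAMILY, REDUCED TO ITS ANALYTIC INPUTS**: `AttainShape (IsFlagTriple d) p` follows from the bounds (D-0c) and from
`s`-ATTAINMENT IN THE TOP CLASS WHEN IT IS AN `n = 0` CLASS (D-0d: `D` the largest `d`-component of all valid admissible flags, no valid
admissible flag with `d = D` tangent) — tangent top classes have `s ≡ 0` and attain trivially.
[cite: Perlega2020, Props. 7.4.8, 7.4.10, Lemma 7.4.11, Prop. 5.3.5 (arXiv:2011.14443 §7.4.3, §5.3)] -/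
theorem attainShape_isFlagTriple_of {d : ℕ} (p : ℕ)
    (hbounds : ∀ (A : Fin d → MvPowerSeries (Fin 2) k) (E : Finset (Fin 2)), IsPos d A → ¬ Exit₃ p d A →
      (∃ v, IsFlagTriple d A E v ∧ 0 < (ofLex v).1) ∧ (∃ dstar : ℕ, ∀ v, IsFlagTriple d A E v → (ofLex v).1 ≤ dstar) ∧
        ∃ N : ℕ, ∀ v, IsFlagTriple d A E v → N ≤ (ofLex (ofLex v).2).1 → (ofLex v).1 = 0)
    (hattain₀ : ∀ (A : Fin d → MvPowerSeries (Fin 2) k) (E : Finset (Fin 2)), IsPos d A → ¬ Exit₃ p d A →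
      ∀ D : ℕ, 0 < D → (∃ v, IsFlagTriple d A E v ∧ (ofLex v).1 = D ∧ (ofLex (ofLex v).2).1 = 0) →
        (∀ w, IsFlagTriple d A E w → (ofLex w).1 ≤ D) → (∀ w, IsFlagTriple d A E w → (ofLex w).1 = D → (ofLex (ofLex w).2).1 = 0) →
        ∃ v, IsFlagTriple d A E v ∧ (ofLex v).1 = D ∧ (ofLex (ofLex v).2).1 = 0 ∧ (ofLex (ofLex v).2).2 ≠ ⊤ ∧
          ∀ w, IsFlagTriple d A E w → (ofLex w).1 = D → (ofLex (ofLex w).2).1 = 0 → (ofLex (ofLex w).2).2 ≤ (ofLex (ofLex v).2).2) :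
    AttainShape (IsFlagTriple (k := k) d) p := by
  refine attainShape_of_bounds_of_attain_top _ p hbounds fun A E hA hexit D n hD hex hDle hnle => ?_
  rcases Nat.eq_zero_or_pos n with hn0 | hnpos
  · subst hn0
    exact hattain₀ A E hA hexit D hD hex hDle (fun w hw hwD => Nat.le_zero.mp (hnle w hw hwD))
  · obtain ⟨v, hv, hvD, hvn⟩ := hex
    have hv0 : (ofLex (ofLex v).2).2 = 0 := isFlagTriple_thd_eq_zero_of_snd_pos hv (by rw [hvn]; exact hnpos)
    refine ⟨v, hv, hvD, hvn, ?_, fun w hw _ hwn => ?_⟩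
    · rw [hv0]
      exact ENat.coe_ne_top 0
    · rw [hv0, isFlagTriple_thd_eq_zero_of_snd_pos hw (by rw [hwn]; exact hnpos)]

end WildMonic

end Summit.ResolutionOfSingularities.ResolutionOfSingularities.Theorems
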